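import Mathlib
import HarnessLib
import Summits.NavierStokesRegularity.NavierStokesRegularity.Theses.StretchingWellBinding
import Summits.NavierStokesRegularity.NavierStokesRegularity.Theses.TerminalTrace
import Summits.NavierStokesRegularity.NavierStokesRegularity.Theorems.TerminalTraceBlowupHasSingularPoint
import Summits.NavierStokesRegularity.NavierStokesRegularity.Theorems.BlowupAssembly
import Summits.NavierStokesRegularity.NavierStokesRegularity.Theorems.AdiabaticEddyClayUniqueness
import Summits.NavierStokesRegularity.NavierStokesRegularity.Theorems.QuarterJoltEdgeLaw
import Summits.NavierStokesRegularity.NavierStokesRegularity.Theorems.StretchingWellBindingEnstrophyQuarterLawTraceTransferGlue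
import Summits.NavierStokesRegularity.NavierStokesRegularity.Theorems.StretchingWellBindingEnstrophyQuarterLawTraceTransferFastL3
import Summits.NavierStokesRegularity.NavierStokesRegularity.Theorems.StretchingWellBindingEnstrophyQuarterLawTraceTransferSlowSet
import Summits.NavierStokesRegularity.NavierStokesRegularity.Theorems.StretchingWellBindingEnstrophyQuarterLawTraceTransferESSVertex

/-!
# Shelf 1574 ⇒ TerminalTrace 18384 / 18385: the quarter law SCARS THE TERMINAL SLICE (LINE 9 «trace_transfer»,
# by name, sorry-free)

Composition file (`--supports stmt-NavierStokesRegularity-1574 --as helper`; KEY-NS #136 (1): "what lands is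
booked as TYPED EDGES between open hard cores — structure, not rung movement") of the banked line
`Cruxes/EnstrophyQuarterLaw/Lines/trace_transfer.lean` (ns-idea-9 g4, LINE 9, commit 21fe26308682; idea-crit-8
V35 PASS-WITH-PRICE «corollary grade»; KEY-NS #131 (1)). Its five registered stubs are tree theorems:

* S1 `stub_edgeLaw` = `Theorems.NoTerminalJolt.edgeLaw_lintegral` (ns-qj-p1 g2, `QuarterJoltEdgeLaw.lean`:
  frame + slice law ⇒ `‖u(s) − u(T)‖₂² ≤ D√(T−s)` on a terminal window, via the PROVED sup-rate Type I
  `RecordTimeTypeI`, stmt-22145);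
* S2 `stub_fastL3` (`…TraceTransferFastL3`: Sobolev `Ḣ¹ ⊂ L⁶` + Chebyshev, `C = C_S⁶K³`);
* S3 `stub_traceTransfer` (`…TraceTransferSlowSet`: the pointwise slow-set inequality
  `|u(s)|³ ≤ 12λ|u(s) − u(T)|² + 8|u(T)|³`, `λ = (T−s)^{-1/2}`, integrated with `λ·D√(T−s) = D`);
* S4 `stub_regular_of_localSliceL3` (`…TraceTransferESSVertex`: the §14.3 class on a top cylinder +
  Escauriaza–Seregin–Šverák's local theorem `ess_bounded_near_top_of_L3`, tree-discharged);
* S5 `stub_not_hasSmoothExtensionPast_of_backwardSingular` (`…TraceTransferGlue`).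

THE THEOREMS (all by name against the route files; compositions copied from the line file with the stubs
replaced by the landed theorems):

* `not_memLp_three_of_sliceLaw_of_backwardSingular` — PER SOLUTION, no shelf hypothesis and no maximality:
  a classical Leray–Hopf solution from a rapidly decaying datum whose enstrophy obeys the slice law
  `∫|curl u(t)|² ≤ K/√(T−t)` on `[0, T)` scars its terminal slice out of `L³` of every ball around every
  backward-singular vertex `(T, x₀)`.
* `traceScarL3_of_enstrophyQuarterLaw : EnstrophyQuarterLaw → TerminalTrace.TraceScarL3` (1574 ⇒ 18384);
* `typeITraceScarL3_of_enstrophyQuarterLaw : EnstrophyQuarterLaw → TerminalTrace.TypeITraceScarL3` (1574 ⇒ 18385;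
  the Type-I hypothesis is not used);
* `exists_l3Scar_of_enstrophyQuarterLaw` — on the shelf every maximal Fefferman-class solution has a point where
  the terminal slice lies in `L³` of NO ball (with `terminalTrace_blowupHasSingularPoint_proof`);
* `navierStokesRegularity_iff_l3Trace_of_enstrophyQuarterLaw` — ON THE SHELF, Clay (A) ⟺ "the terminal slice of
  every maximal Fefferman-class solution is locally `L³` at every point" (the line's `L3Trace`, written INLINE —
  no new `Prop` is introduced here); ⇒ by vacuity (`blowup_assembly` + the PROVED Clay-class uniqueness
  `adiabaticEddy_clayUniqueness_proof`), ⇐ via the PROVED `NoBlowupToClay_holds`. Zero independent width: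
  a calibration currency, booked as such (idea-crit-8 V35).

HONEST FRAME (KEY-NS #136): these are typed edges between OPEN statements. `EnstrophyQuarterLaw` (1574),
`TraceScarL3` (18384), `TypeITraceScarL3` (18385), `TypeIliouvilleNoTypeII` (0056) stay OPEN; nothing here
proves NS regularity. idea-crit-8 V35: both cross-shelf edges are also corollaries of {22145 PROVED, 18385 open
(paper route Albritton–Barker L2.5 + ESS)}; this file is the elementary shelf-specific proof path (energy edge
law + Chebyshev + measure theory + tree-discharged ESS local), with zero slack at the shelf exponent 1/2.
-/

noncomputable section

-- the summit-side namespace repeats a component by design (D-0017)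
set_option linter.dupNamespace false

namespace Summit.NavierStokesRegularity.NavierStokesRegularity.Theorems.EnstrophyQuarterLaw.TraceTransfer

open Set MeasureTheory Function Metric
open scoped ENNReal NNReal
open Literature.Analysis.FluidPDE

/-- **The slice law scars the terminal slice — per solution, unconditional.** For `ν > 0`, `T > 0`, `(u, p)`
classical on `[0, T) × ℝ³`, Leray–Hopf on `[0, T]` from the rapidly decaying datum `u 0`, with the slice law
`∫ |curl u(t)|² ≤ K/√(T−t)` on `[0, T)`: at every vertex `(T, x₀)` where `u` is essentially unbounded on every
backward parabolic cylinder, the terminal slice `u(T)` lies in `L³` of NO ball `B(x₀, ρ)`. Composition of the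
edge law (`NoTerminalJolt.edgeLaw_lintegral`), the fast bound (`stub_fastL3`), the trace transfer
(`stub_traceTransfer`) and ESS's local theorem at the vertex (`stub_regular_of_localSliceL3`). [folklore] -/
theorem not_memLp_three_of_sliceLaw_of_backwardSingular {ν T : ℝ} (hν : 0 < ν) (hT : 0 < T)
    {u : ℝ → EuclideanSpace ℝ (Fin 3) → EuclideanSpace ℝ (Fin 3)} {p : ℝ → EuclideanSpace ℝ (Fin 3) → ℝ}
    (hcl : IsClassicalNSSolutionOn (Set.Ico 0 T) ν 0 u p) (hLH : IsLerayHopfOn T ν 0 (u 0) u)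
    (hdec : HasRapidSpatialDecay (u 0)) {K : ℝ}
    (hK : ∀ t ∈ Set.Ico 0 T, ∫⁻ x, ‖curl (u t) x‖ₑ ^ 2 ≤ ENNReal.ofReal (K / Real.sqrt (T - t)))
    {x₀ : EuclideanSpace ℝ (Fin 3)}
    (hsing : ∀ r : ℝ, 0 < r → eLpNorm (uncurry u) ⊤ (volume.restrict (parabolicCylinder r (T, x₀))) = ⊤)
    {ρ : ℝ} (hρ : 0 < ρ) : ¬ MemLp (u T) 3 (volume.restrict (ball x₀ ρ)) := by
  intro hL3
  obtain ⟨D, t₀, ht₀, ht₀T, hD⟩ := NoTerminalJolt.edgeLaw_lintegral ν T hν hT u p hcl hLH hdec K hK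
  obtain ⟨C, hC⟩ := stub_fastL3 ν T hν hT u p hcl hLH hdec K hK
  have hloc := stub_traceTransfer ν T hν hT u p hcl hLH D t₀ C ht₀ ht₀T hD hC x₀ ρ hρ hL3
  obtain ⟨r, hr, hfin⟩ := stub_regular_of_localSliceL3 ν T hν hT u p hcl hLH hdec x₀ ρ hρ hloc
  exact absurd (hsing r hr) hfin.ne

/-- **EQL ⇒ TraceScarL3** (stmt-NavierStokesRegularity-1574 ⇒ stmt-NavierStokesRegularity-18384, BY NAME): on the
quarter-law shelf every backward-singular vertex scars the terminal slice out of `L³` of every ball. The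
backward-singular vertex makes `T` maximal (`stub_not_hasSmoothExtensionPast_of_backwardSingular`), the shelf
crux supplies the slice law, and `not_memLp_three_of_sliceLaw_of_backwardSingular` concludes. A typed edge
between two OPEN statements; neither is proved. [folklore] -/
theorem traceScarL3_of_enstrophyQuarterLaw (hQ : Theses.StretchingWellBinding.EnstrophyQuarterLaw) :
    Theses.TerminalTrace.TraceScarL3 := by
  intro ν T hν hT u p hcl hLH hdec x₀ hsing ρ hρ
  have hmax : IsMaximalSmoothSolution ν 0 u p T :=
    ⟨hcl, stub_not_hasSmoothExtensionPast_of_backwardSingular ν T hν hT u p hcl x₀ hsing⟩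
  obtain ⟨K, hK⟩ := hQ ν T hν hT u p hmax hLH hdec
  exact not_memLp_three_of_sliceLaw_of_backwardSingular hν hT hcl hLH hdec hK hsing hρ

/-- **EQL ⇒ TypeITraceScarL3** (stmt-NavierStokesRegularity-1574 ⇒ stmt-NavierStokesRegularity-18385, BY NAME):
the Type-I cell follows a fortiori — the Type-I hypothesis is not even used (the quarter law already pays the
fast part). A typed edge between two OPEN statements. [folklore] -/
theorem typeITraceScarL3_of_enstrophyQuarterLaw (hQ : Theses.StretchingWellBinding.EnstrophyQuarterLaw) :
    Theses.TerminalTrace.TypeITraceScarL3 :=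
  fun ν T hν hT u p hcl hLH hdec _ x₀ hsing ρ hρ =>
    traceScarL3_of_enstrophyQuarterLaw hQ ν T hν hT u p hcl hLH hdec x₀ hsing ρ hρ

/-- **Complete `L³` blow-up on the shelf**: under the quarter law every maximal Fefferman-class solution has a
point at which the terminal slice lies in `L³` of NO ball (the singular point of
`terminalTrace_blowupHasSingularPoint_proof` + `traceScarL3_of_enstrophyQuarterLaw`). Conditional on the OPEN
shelf crux. [folklore] -/
theorem exists_l3Scar_of_enstrophyQuarterLaw (hQ : Theses.StretchingWellBinding.EnstrophyQuarterLaw) :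
    ∀ (ν T : ℝ), 0 < ν → 0 < T →
      ∀ (u : ℝ → EuclideanSpace ℝ (Fin 3) → EuclideanSpace ℝ (Fin 3)) (p : ℝ → EuclideanSpace ℝ (Fin 3) → ℝ),
        IsMaximalSmoothSolution ν 0 u p T → IsLerayHopfOn T ν 0 (u 0) u → HasRapidSpatialDecay (u 0) →
        ∃ x₀ : EuclideanSpace ℝ (Fin 3), ∀ ρ : ℝ, 0 < ρ → ¬ MemLp (u T) 3 (volume.restrict (ball x₀ ρ)) := by
  intro ν T hν hT u p hmax hLH hdec
  obtain ⟨xs, hxs⟩ :=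
    Theorems.terminalTrace_blowupHasSingularPoint_proof ν T hν hT u p hmax.1 hLH hdec hmax.2
  exact ⟨xs, traceScarL3_of_enstrophyQuarterLaw hQ ν T hν hT u p hmax.1 hLH hdec xs hxs⟩

/-- **Summit edge, direction ⇐** (the line's `navierStokesRegularity_of_enstrophyQuarterLaw_of_l3Trace`, with its
currency `L3Trace` written inline): the quarter law and "the terminal slice of every maximal Fefferman-class
solution is locally `L³` at every point" together give Clay (A), via the PROVED local-theory assembly
`NoBlowupToClay_holds`. BOTH hypotheses are OPEN; no summit statement is proved. [folklore] -/
theorem navierStokesRegularity_of_enstrophyQuarterLaw_of_l3Trace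
    (hQ : Theses.StretchingWellBinding.EnstrophyQuarterLaw)
    (hL : ∀ (ν T : ℝ), 0 < ν → 0 < T →
      ∀ (u : ℝ → EuclideanSpace ℝ (Fin 3) → EuclideanSpace ℝ (Fin 3)) (p : ℝ → EuclideanSpace ℝ (Fin 3) → ℝ),
        IsMaximalSmoothSolution ν 0 u p T → IsLerayHopfOn T ν 0 (u 0) u → HasRapidSpatialDecay (u 0) →
        ∀ x₀ : EuclideanSpace ℝ (Fin 3), ∃ ρ : ℝ, 0 < ρ ∧ MemLp (u T) 3 (volume.restrict (ball x₀ ρ))) :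
    _root_.NavierStokesRegularity := by
  refine Theses.StretchingWellBinding.NoBlowupToClay_holds ?_
  intro ν T hν hT u p hcl hLH hdec
  by_contra hext
  obtain ⟨xs, hxs⟩ := exists_l3Scar_of_enstrophyQuarterLaw hQ ν T hν hT u p ⟨hcl, hext⟩ hLH hdec
  obtain ⟨ρ, hρ, hmem⟩ := hL ν T hν hT u p ⟨hcl, hext⟩ hLH hdec xs
  exact hxs ρ hρ hmem

/-- **Summit edge, direction ⇒** (vacuity: under Clay (A) no Fefferman-class solution is maximal —
`blowup_assembly` with the PROVED Clay-class uniqueness `adiabaticEddy_clayUniqueness_proof`); the line's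
`l3Trace_of_navierStokesRegularity` with `L3Trace` inline. [folklore] -/
theorem l3Trace_of_navierStokesRegularity (hA : _root_.NavierStokesRegularity) :
    ∀ (ν T : ℝ), 0 < ν → 0 < T →
      ∀ (u : ℝ → EuclideanSpace ℝ (Fin 3) → EuclideanSpace ℝ (Fin 3)) (p : ℝ → EuclideanSpace ℝ (Fin 3) → ℝ),
        IsMaximalSmoothSolution ν 0 u p T → IsLerayHopfOn T ν 0 (u 0) u → HasRapidSpatialDecay (u 0) →
        ∀ x₀ : EuclideanSpace ℝ (Fin 3), ∃ ρ : ℝ, 0 < ρ ∧ MemLp (u T) 3 (volume.restrict (ball x₀ ρ)) := by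
  intro ν T hν hT u p hmax hLH hdec x₀
  exact absurd hA (Literature.NS.blowup_assembly
    ⟨⟨ν, hν, T, hT, u, p, hmax, hLH, hdec⟩, Theorems.adiabaticEddy_clayUniqueness_proof⟩)

/-- **On the shelf, Clay (A) ⟺ L3Trace** (the line's `navierStokesRegularity_iff_l3Trace_of_enstrophyQuarterLaw`,
currency inline): GIVEN the OPEN quarter law, NS regularity is equivalent to "the terminal slice of every maximal
Fefferman-class solution is locally `L³` at every point". Zero independent width — a calibration currency (idea-crit-8
V35); nothing here proves either side. [folklore] -/
theorem navierStokesRegularity_iff_l3Trace_of_enstrophyQuarterLaw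
    (hQ : Theses.StretchingWellBinding.EnstrophyQuarterLaw) :
    _root_.NavierStokesRegularity ↔
      ∀ (ν T : ℝ), 0 < ν → 0 < T →
        ∀ (u : ℝ → EuclideanSpace ℝ (Fin 3) → EuclideanSpace ℝ (Fin 3)) (p : ℝ → EuclideanSpace ℝ (Fin 3) → ℝ),
          IsMaximalSmoothSolution ν 0 u p T → IsLerayHopfOn T ν 0 (u 0) u → HasRapidSpatialDecay (u 0) →
          ∀ x₀ : EuclideanSpace ℝ (Fin 3), ∃ ρ : ℝ, 0 < ρ ∧ MemLp (u T) 3 (volume.restrict (ball x₀ ρ)) :=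
  ⟨l3Trace_of_navierStokesRegularity, navierStokesRegularity_of_enstrophyQuarterLaw_of_l3Trace hQ⟩

end Summit.NavierStokesRegularity.NavierStokesRegularity.Theorems.EnstrophyQuarterLaw.TraceTransfer

end
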